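import Literature.Analysis.FluidPDE.CollisionalTransfer
import Literature.Analysis.FluidPDE.CollisionalTransferFunctionalMeasurable
import Literature.Analysis.FluidPDE.HardSphereCollisionRecord
import Literature.MathematicalPhysics.KineticTheory.HardSphereTwoTimePressure
import Literature.MathematicalPhysics.KineticTheory.HardSphereEulerProofs
import Summits.AtomisticToContinuum.HydrodynamicLimit.Theorems.OneFlightGossipEngineSuperExponentialEnergyTailsDefsB
import HarnessLib

/-!
# The exact power ledger of the true-law velocity moments (stub R of line `Sketch`,
# crux `SuperExponentialEnergyTails`, stmt-AtomisticToContinuum-17701), stage 1/4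

Stub worker file for the registered stub `stub_momentRegularity : MomentRegularity` of the line lead's
skeleton `Cruxes/SuperExponentialEnergyTails/Lines/Sketch.lean` (lead
prover-line-stmt-AtomisticToContinuum-17701-0).  This first stage proves the field `ledger` of
`SuperExponentialEnergyTailsLine.MomentRegularityFor` for EVERY power `p : ℕ`, as the registered helper
`momentPowerLedger`: for `0 < σ < 1/2`, every `N`, every hard-sphere flow `Φ` of `N + 1` spheres of diameter
`hsDiameter σ N` on `𝕋³`, `0 ≤ s ≤ s'` and `λ_N = localGibbsLaw σ a₀ u₀ θ₀ N Φ`,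
`velMoment p s' + preMomentSum p (s, s'] = velMoment p s + postMomentSum p (s, s']` in `ℝ≥0∞`.

**Proof** (the landed quartic ledger `QuarticSchurLedger.stub_quarticLedger` with the power `4` replaced by
`p`).  Along a hard-sphere trajectory (`z ∈ Φ.good`) the observable `F_p(w) = ∑ᵢ ‖(w i).2‖ᵖ` is constant on
free flights (`freeFlight_apply`), so the weak balance law
`IsHardSphereTrajectory.sub_eq_integral_add_collisionalTransfer` with streaming derivative `0` gives
`F_p(γ s') − F_p(γ s) = collisionalTransfer F_p`.  By `collisionalTransferFunctional_jumpKernel` +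
`collisionalTransferFunctional_eq_collisionSum` (regular torus geometry, `Torus.isHardSphereRegular_geometry`
for `hsDiameter σ N ≤ σ < 1/2`) the transfer is the collision sum of `Δ_p/2` over the records
(`collisionJump_powSum`: at a binary collision only the pair jumps, `apply_eq_leftLim_apply_of_ne`;
`ofConfig_preVel_eq_leftLim`, `ofConfig_postVel`), and `Δ_p/2 = post half-kernel − pre half-kernel`
(`collisionPairSum_add`).  Both half-kernels and both power sums are `≥ 0`, `ENNReal.ofReal` is additive on
them, and `lintegral_add_left` (measurability of the moment integrand only, `HardSphereFlow.measurable_flow`)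
+ `lintegral_congr_ae` over `ae_mem_good_localGibbsLaw` integrate the pointwise identity.  No integrability of
the collision sums is needed.

References: Cercignani–Illner–Pulvirenti 1994 §4.2 (weak form along trajectories); Bobylev 1997 /
Mischler–Wennberg 1999 (power bookkeeping of Povzner type).
-/

noncomputable section

open MeasureTheory Set Filter
open scoped ENNReal InnerProductSpace

namespace Summit.AtomisticToContinuum.HydrodynamicLimit.Theorems.SuperExponentialEnergyTailsMomentRegularity

open Literature.MathematicalPhysics.KineticTheory Literature.Analysis.FluidPDE
open Summit.AtomisticToContinuum.HydrodynamicLimit.Theorems.SuperExponentialEnergyTailsLine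
  (velMoment preMomentSum postMomentSum)

section Trajectory

variable {d : Type*} [Fintype d] {X : Type*} [TopologicalSpace X] [T2Space X] {n : ℕ}
  {G : Geometry d X} {ε : ℝ} {γ : ℝ → Config n d X}

/-- **The jump of the power observable at a binary collision.**  At a collision of the pair `{i, j}` of a
hard-sphere trajectory only the pair's velocities jump (`IsHardSphereTrajectory.apply_eq_leftLim_apply_of_ne`),
so the jump of `w ↦ ∑ₖ ‖(w k).2‖ᵖ` is `‖vᵢ⁺‖ᵖ + ‖vⱼ⁺‖ᵖ − ‖vᵢ⁻‖ᵖ − ‖vⱼ⁻‖ᵖ`. [folklore] -/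
theorem collisionJump_powSum (h : IsHardSphereTrajectory G ε n γ) (p : ℕ) {t : ℝ} {i j : Fin n}
    (hij : i ≠ j) (hc : γ t ∈ contactSet G n ε i j) :
    collisionJump (fun w : Config n d X => ∑ k, ‖(w k).2‖ ^ p) γ t =
      ‖(γ t i).2‖ ^ p + ‖(γ t j).2‖ ^ p
        - ‖(Function.leftLim γ t i).2‖ ^ p - ‖(Function.leftLim γ t j).2‖ ^ p := by
  have hdiff : collisionJump (fun w : Config n d X => ∑ k, ‖(w k).2‖ ^ p) γ t =
      ∑ k, (‖(γ t k).2‖ ^ p - ‖(Function.leftLim γ t k).2‖ ^ p) := by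
    simp only [collisionJump, Finset.sum_sub_distrib]
  rw [hdiff, Fintype.sum_eq_add i j hij]
  · ring
  · intro k hk
    rw [h.apply_eq_leftLim_apply_of_ne hij hc hk.1 hk.2, sub_self]

/-- **The collisional transfer of the power observable is the collision sum of `Δ_p/2`.**  In a regular
geometry the ordered contact pairs at a collision of `{i, j}` are `(i, j)` and `(j, i)`, each record carrying
the same `Δ_p = ‖v₁⁺‖ᵖ + ‖v₂⁺‖ᵖ − ‖v₁⁻‖ᵖ − ‖v₂⁻‖ᵖ` (post-velocities read off `γ t`, pre-velocities the left
limits, `IsHardSphereTrajectory.ofConfig_preVel_eq_leftLim`), i.e. half the jump each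
(`collisionalTransferFunctional_jumpKernel`). [folklore] -/
theorem collisionalTransfer_powSum_eq_collisionSum (h : IsHardSphereTrajectory G ε n γ)
    (hG : G.IsHardSphereRegular ε) (p : ℕ) (a b : ℝ) :
    collisionalTransfer G ε (fun w : Config n d X => ∑ k, ‖(w k).2‖ ^ p) γ a b =
      collisionSum G ε γ (Ioc a b) fun col =>
        (‖col.postVel.1‖ ^ p + ‖col.postVel.2‖ ^ p
          - ‖col.preVel.1‖ ^ p - ‖col.preVel.2‖ ^ p) / 2 := by
  rw [← h.collisionalTransferFunctional_jumpKernel]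
  refine collisionalTransferFunctional_eq_collisionSum hG fun t _ q hq => ?_
  obtain ⟨i, j⟩ := q
  obtain ⟨hij, hc⟩ := mem_contactPairs.1 hq
  rw [h.ofConfig_preVel_eq_leftLim hq]
  change (2 : ℝ)⁻¹ • collisionJump (fun w : Config n d X => ∑ k, ‖(w k).2‖ ^ p) γ t = _
  rw [collisionJump_powSum h p hij hc]
  simp only [HardSphereCollisionRecord.ofConfig_postVel, smul_eq_mul]
  ring

/-- **The pathwise power ledger** along a hard-sphere trajectory in a regular geometry: for `a ≤ b`,
`∑ₖ ‖vₖ(b)‖ᵖ + collisionSum_{(a,b]} (‖v₁⁻‖ᵖ + ‖v₂⁻‖ᵖ)/2 = ∑ₖ ‖vₖ(a)‖ᵖ + collisionSum_{(a,b]} (‖v₁⁺‖ᵖ + ‖v₂⁺‖ᵖ)/2`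
(velocities are constant on free flights, so the weak balance law has no streaming term; the collisional term is
the collision sum of `Δ_p/2 = post half-kernel − pre half-kernel`). [folklore] -/
theorem powSum_add_collisionSum_eq (h : IsHardSphereTrajectory G ε n γ)
    (hG : G.IsHardSphereRegular ε) (p : ℕ) {a b : ℝ} (hab : a ≤ b) :
    (∑ k, ‖(γ b k).2‖ ^ p) +
        collisionSum G ε γ (Ioc a b) (fun col => (‖col.preVel.1‖ ^ p + ‖col.preVel.2‖ ^ p) / 2) =
      (∑ k, ‖(γ a k).2‖ ^ p) +
        collisionSum G ε γ (Ioc a b) (fun col => (‖col.postVel.1‖ ^ p + ‖col.postVel.2‖ ^ p) / 2) := by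
  -- the weak balance law with vanishing streaming derivative
  have hF : ∀ (z : Config n d X) (t : ℝ),
      HasDerivAt (fun s => ∑ k, ‖(freeFlight G s z k).2‖ ^ p) (0 : ℝ) t := fun z t => by
    simp only [freeFlight_apply]
    exact hasDerivAt_const t _
  have hbal := (h.sub_eq_integral_add_collisionalTransfer
    (F := fun w : Config n d X => ∑ k, ‖(w k).2‖ ^ p) (F' := fun _ : Config n d X => (0 : ℝ))
    hG.continuous_translate_left hF (fun _ => continuous_const) hab).2
  simp only [intervalIntegral.integral_zero, zero_add] at hbal
  rw [collisionalTransfer_powSum_eq_collisionSum h hG p a b] at hbal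
  -- split `Δ_p/2 = post/2 - pre/2`
  have hfin := h.finite_collisionTimes_inter_Ioc a b
  have hsplit : collisionSum G ε γ (Ioc a b)
        (fun col => (‖col.postVel.1‖ ^ p + ‖col.postVel.2‖ ^ p) / 2) =
      collisionSum G ε γ (Ioc a b) (fun col =>
        (‖col.postVel.1‖ ^ p + ‖col.postVel.2‖ ^ p
          - ‖col.preVel.1‖ ^ p - ‖col.preVel.2‖ ^ p) / 2) +
      collisionSum G ε γ (Ioc a b)
        (fun col => (‖col.preVel.1‖ ^ p + ‖col.preVel.2‖ ^ p) / 2) := by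
    simp only [collisionSum_eq_collisionPairSum]
    rw [← collisionPairSum_add hfin]
    congr 1
    funext t i j
    ring
  linarith

end Trajectory

/-- Measurability of the normalised power integrand `z ↦ ofReal ((N+1)⁻¹ ∑ᵢ ‖vᵢ(r)‖ᵖ)` along a hard-sphere
flow (each `Φ.flow r` is measurable). [folklore] -/
theorem measurable_ofReal_powSum_flow {N : ℕ} {ε : ℝ}
    (Φ : HardSphereFlow (Torus.geometry (Fin 3)) ε (N + 1)) (p : ℕ) (r : ℝ) :
    Measurable fun z : Config (N + 1) (Fin 3) T3 =>
      ENNReal.ofReal (((N : ℝ) + 1)⁻¹ * ∑ i : Fin (N + 1), ‖(Φ.flow r z i).2‖ ^ p) := by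
  refine ENNReal.measurable_ofReal.comp (Measurable.const_mul ?_ _)
  refine Finset.measurable_sum _ fun i _ => ?_
  exact (((measurable_pi_apply i).comp (Φ.measurable_flow r)).snd.norm).pow_const p

/-- **Stage 1 of stub R — THE EXACT POWER LEDGER (in expectation)**, registered helper `momentPowerLedger` of
`stub_momentRegularity` (line `Sketch`, crux stmt-AtomisticToContinuum-17701): for `0 < σ < 1/2`, every `N`,
every hard-sphere flow `Φ`, every power `p` and `0 ≤ s ≤ s′`,
`velMoment p s′ + preMomentSum p (s, s′] = velMoment p s + postMomentSum p (s, s′]` as extended non-negative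
reals under `λ_N = localGibbsLaw σ a₀ u₀ θ₀ N Φ`.  Pathwise on `Φ.good` this is `powSum_add_collisionSum_eq`
(regular torus geometry since `hsDiameter σ N ≤ σ < 1/2`); `ENNReal.ofReal` is additive on the four non-negative
terms, and the identity integrates by `lintegral_add_left` and `lintegral_congr_ae` over the `λ_N`-conull good
set (`ae_mem_good_localGibbsLaw`).  This is the field `ledger` of `MomentRegularityFor σ a₀ u₀ θ₀`. [folklore] -/
theorem momentPowerLedger :
    ∀ (a₀ θ₀ : T3 → ℝ) (u₀ : T3 → V3) (σ : ℝ), 0 < σ → σ < 1 / 2 →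
      ∀ (N : ℕ) (Φ : HardSphereFlow (Torus.geometry (Fin 3)) (hsDiameter σ N) (N + 1)) (p : ℕ) (s s' : ℝ),
        0 ≤ s → s ≤ s' →
          velMoment Φ (localGibbsLaw σ a₀ u₀ θ₀ N Φ) p s' + preMomentSum Φ (localGibbsLaw σ a₀ u₀ θ₀ N Φ) p s s'
            = velMoment Φ (localGibbsLaw σ a₀ u₀ θ₀ N Φ) p s + postMomentSum Φ (localGibbsLaw σ a₀ u₀ θ₀ N Φ) p s s' := by
  intro a₀ θ₀ u₀ σ hσ hσ2 N Φ p s s' _hs hss'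
  have hε : hsDiameter σ N < 2⁻¹ := (hsDiameter_le hσ.le N).trans_lt (by linarith)
  have hG : (Torus.geometry (Fin 3)).IsHardSphereRegular (hsDiameter σ N) :=
    Torus.isHardSphereRegular_geometry hε
  have hc : (0 : ℝ) ≤ ((N : ℝ) + 1)⁻¹ := by positivity
  simp only [velMoment, preMomentSum, postMomentSum]
  rw [← lintegral_add_left (measurable_ofReal_powSum_flow Φ p s'),
    ← lintegral_add_left (measurable_ofReal_powSum_flow Φ p s)]
  refine lintegral_congr_ae ?_
  filter_upwards [ae_mem_good_localGibbsLaw σ a₀ u₀ θ₀ N Φ] with z hz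
  have hγ := Φ.isTrajectory z hz
  have hled := powSum_add_collisionSum_eq hγ hG p hss'
  -- non-negativity of the four terms
  have hY' : 0 ≤ ((N : ℝ) + 1)⁻¹ * ∑ i : Fin (N + 1), ‖(Φ.flow s' z i).2‖ ^ p :=
    mul_nonneg hc (Finset.sum_nonneg fun i _ => by positivity)
  have hY : 0 ≤ ((N : ℝ) + 1)⁻¹ * ∑ i : Fin (N + 1), ‖(Φ.flow s z i).2‖ ^ p :=
    mul_nonneg hc (Finset.sum_nonneg fun i _ => by positivity)
  have hL : 0 ≤ ((N : ℝ) + 1)⁻¹ * Φ.collisionSum (Set.Ioc s s')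
      (fun col => (‖col.preVel.1‖ ^ p + ‖col.preVel.2‖ ^ p) / 2) z := by
    refine mul_nonneg hc ?_
    rw [HardSphereFlow.collisionSum_eq, collisionSum_eq_collisionPairSum]
    exact collisionPairSum_nonneg fun _ _ _ => by positivity
  have hGn : 0 ≤ ((N : ℝ) + 1)⁻¹ * Φ.collisionSum (Set.Ioc s s')
      (fun col => (‖col.postVel.1‖ ^ p + ‖col.postVel.2‖ ^ p) / 2) z := by
    refine mul_nonneg hc ?_
    rw [HardSphereFlow.collisionSum_eq, collisionSum_eq_collisionPairSum]
    exact collisionPairSum_nonneg fun _ _ _ => by positivity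
  rw [← ENNReal.ofReal_add hY' hL, ← ENNReal.ofReal_add hY hGn, ← mul_add, ← mul_add,
    HardSphereFlow.collisionSum_eq, HardSphereFlow.collisionSum_eq, hled]

end Summit.AtomisticToContinuum.HydrodynamicLimit.Theorems.SuperExponentialEnergyTailsMomentRegularity

end
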